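import Summits.QuantumFields.YangMills.Theorems.ForcedResponseSkewnessResponseLocalisationSmearedKernelToolkit
import HarnessLib

/-!
# Route `ForcedResponseSkewness`, crux `ResponseLocalisation` (stmt-QuantumFields-24869), line «smeared-femto»:
# the per-site collar bound with a smeared near observable

Second helper file of the registered analysis stub `stub_smearedKernelOfFemto : SmearedKernelOfFemtoSigR` (lead `ym-line-frs-p1` g4;
`--supports stmt-QuantumFields-24869`).  With the radius-`M+1` cubes around the far site `y` and the near centre `z₁` femto, injective
on the torus and torus-separated, FBL at `β`, and the smeared near-pair law at `β` specialised to the weights `w_z` (support `S`, all of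
it within `M/8` of `z₁`), the site `x' = z₁ + v` (`|v_j| ≤ M/8`) satisfies

`|Σ_{z∈S} w_z κ₃^T(x', y, z)| ≤ 4 · (C₁+1)/M⁴ · [ (κ' + Σ_z |w_z| μ(z − z₁ − v)) / (M/2)⁴ + (Σ_z |w_z|) · 1024 (C₁+1)²/M⁸ ]`

— the two-observable collar bound (`Femto.abs_integral_two_sub_mean_le`, Georgii Thm. 4.17) for `A₁ = dens y` (tolerance `(C₁+1)/M⁴`) and the
smeared near observable `A₂ = (dens x' − m_{x'}) Σ_z w_z (dens z − m_z)` (tolerance from the smeared near-pair law + FBL twice), after the smeared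
identity `Σ_z w_z κ₃ = ⟨(dens y − ⟨dens y⟩)(A₂ − ⟨A₂⟩)⟩`.

* `abs_kerE_smeared_sub_le` — the kernel-mean deviation of `A₂` from `Σ_z w_z n(z)` is at most (law bound) + `(Σ|w_z|)·δ₁δ₂`;
* `perSite_bound` — the bound displayed above.

No summit is proved by any of this (leaf R2a `BalabanLadder.NT`, conditional rung line; the YM mass gap is NOT proved).
Refs: Georgii, Gibbs Measures and Phase Transitions (2011) Thm. 4.17.
-/

set_option autoImplicit false

noncomputable section

namespace Summit.QuantumFields.YangMills.Cruxes.ResponseLocalisation.Smeared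

open MeasureTheory Filter Topology
open Literature.MathematicalPhysics.QuantumFieldTheory Literature.MathematicalPhysics.QuantumLattice
open Literature.Probability.LatticeModels
open Summit.QuantumFields.YangMills.Cruxes.OSLegsFromFemtoAndGap.DlrCollarTransfer
open Summit.QuantumFields.YangMills.Cruxes.RunningCouplingCeiling.Pointwise (torusDist)
open Summit.QuantumFields.YangMills.Cruxes.ResponseLocalisation.Birth
open Summit.QuantumFields.YangMills.Cruxes.ResponseLocalisation.Femto

variable {G : Type} [Group G] [TopologicalSpace G] [IsTopologicalGroup G] [CompactSpace G]
  [MeasurableSpace G] [BorelSpace G] [SecondCountableTopology G] (r : LatticeRep G)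

/-- **Kernel-mean deviation of the smeared near observable**: if `|γ_η dens x − m_x| ≤ δ₁`, `|γ_η dens z − m_z| ≤ δ₂` on `S`, and the
smeared near-pair deviation `|Σ_z w_z (kerCov_η(dens x, dens z) − n_z)|` is `≤ Λw`, then
`|γ_η((dens x − m_x) Σ_z w_z (dens z − m_z)) − Σ_z w_z n_z| ≤ Λw + (Σ_z |w_z|) δ₁ δ₂`. [folklore] -/
theorem abs_kerE_smeared_sub_le (β : ℝ) (c : Fin 4 → ℤ) (b : ℕ) (η : LGConfig 4 G) (x : Fin 4 → ℤ) (S : Finset (Fin 4 → ℤ))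
    (wt : (Fin 4 → ℤ) → ℝ) (mx : ℝ) (m nn : (Fin 4 → ℤ) → ℝ) {δ₁ δ₂ Λw : ℝ}
    (h1 : |kerE G r β c b η (dens G r x) - mx| ≤ δ₁) (h2 : ∀ z ∈ S, |kerE G r β c b η (dens G r z) - m z| ≤ δ₂)
    (hlaw : |∑ z ∈ S, wt z * (kerCov G r β c b η (dens G r x) (dens G r z) - nn z)| ≤ Λw) :
    |kerE G r β c b η (fun U => (dens G r x U - mx) * ∑ z ∈ S, wt z * (dens G r z U - m z)) - ∑ z ∈ S, wt z * nn z| ≤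
      Λw + (∑ z ∈ S, |wt z|) * (δ₁ * δ₂) := by
  rw [kerE_smeared_centred r β c b η x S wt mx m]
  have e2 : (∑ z ∈ S, wt z * (kerCov G r β c b η (dens G r x) (dens G r z) +
        (kerE G r β c b η (dens G r x) - mx) * (kerE G r β c b η (dens G r z) - m z))) - ∑ z ∈ S, wt z * nn z =
      (∑ z ∈ S, wt z * (kerCov G r β c b η (dens G r x) (dens G r z) - nn z)) +
        ∑ z ∈ S, wt z * ((kerE G r β c b η (dens G r x) - mx) * (kerE G r β c b η (dens G r z) - m z)) := by
    rw [← Finset.sum_sub_distrib, ← Finset.sum_add_distrib]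
    refine Finset.sum_congr rfl fun z _ => ?_
    ring
  rw [e2]
  refine (abs_add_le _ _).trans (add_le_add hlaw ?_)
  refine (Finset.abs_sum_le_sum_abs _ _).trans ?_
  rw [Finset.sum_mul]
  refine Finset.sum_le_sum fun z hz => ?_
  rw [abs_mul, abs_mul]
  refine mul_le_mul_of_nonneg_left ?_ (abs_nonneg _)
  exact mul_le_mul h1 (h2 z hz) (abs_nonneg _) ((abs_nonneg _).trans h1)

/-- **Per-site collar bound with a smeared near observable** (see the module docstring): for the representative `x' = z₁ + v`,
`|v_j| ≤ M/8`, of a near-ball site, `|Σ_{z∈S} w_z κ₃^T(x',y,z)| ≤ 4ε₁ε₂(v)` with `ε₁ = (C₁+1)/M⁴` and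
`ε₂(v) = (κ' + Σ_z |w_z| μ(z − z₁ − v))/(M/2)⁴ + (Σ_z |w_z|)·1024(C₁+1)²/M⁸`.  Georgii's conditional independence of separated
volumes, Thm. 4.17. [folklore] -/
theorem perSite_bound (β t ℓ₁ C₁ pβ κ' R Rf : ℝ) (L M : ℕ) (y z₁ : Fin 4 → ℤ) (wt : (Fin 4 → ℤ) → ℝ) (S : Finset (Fin 4 → ℤ))
    (n μ : (Fin 4 → ℤ) → ℝ) {CA : ℝ} (hCA : ∀ (u : Fin 4 → ℤ) (U : LGConfig 4 G), |dens G r u U| ≤ CA)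
    (ht0 : 0 < t) (hC₁ : 0 ≤ C₁) (hκ' : 0 < κ')
    (hF : ∀ (c : Fin 4 → ℤ) (b : ℕ), (b : ℝ) * t ≤ ℓ₁ → ∀ (η : LGConfig 4 G) (x : Fin 4 → ℤ),
      2 ≤ depth c b x → |kerE G r β c b η (dens G r x) - pβ| ≤ C₁ / (depth c b x : ℝ) ^ 4)
    (hM4 : 4 ≤ M) (hb₁ : ((2 * M + 3 : ℕ) : ℝ) * t ≤ ℓ₁) (h4M : 4 * M + 8 ≤ L)
    (hsep_yz : ∃ k : Fin 4, (2 * (M : ℤ) + 4) ≤ |((((y k - z₁ k : ℤ) : ZMod (2 * L + 1))).valMinAbs : ℤ)|)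
    (hsep_zy : ∃ k : Fin 4, (2 * (M : ℤ) + 4) ≤ |((((z₁ k - y k : ℤ) : ZMod (2 * L + 1))).valMinAbs : ℤ)|)
    (hμ0 : ∀ w, 0 ≤ μ w)
    (hlaw : ∀ (η : LGConfig 4 G) (x : Fin 4 → ℤ),
      (∀ z ∈ S, t * ‖siteToE (z - x)‖ ≤ R ∧ 2 * ‖siteToE (z - x)‖ + 2 ≤ (depth (fun k => z₁ k - (M + 1)) (2 * M + 3) x : ℝ)) →
      |∑ z ∈ S, wt z * (kerCov G r β (fun k => z₁ k - (M + 1)) (2 * M + 3) η (dens G r x) (dens G r z) - n (z - x))| ≤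
        (κ' + ∑ z ∈ S, |wt z| * μ (z - x)) / (depth (fun k => z₁ k - (M + 1)) (2 * M + 3) x : ℝ) ^ 4)
    (hS_mem : ∀ z ∈ S, t * ‖siteToE (z - z₁)‖ ≤ Rf) (hSz : ∀ z ∈ S, ∀ j, |(z - z₁) j| ≤ ((M / 8 : ℕ) : ℤ))
    (hsmall : ∀ u : Fin 4 → ℤ, t * ‖siteToE u‖ ≤ Rf → ‖siteToE u‖ ≤ (M : ℝ) / 8) (hRfR : 2 * Rf ≤ R)
    (v : Fin 4 → ℤ) (hv : ∀ j, |v j| ≤ ((M / 8 : ℕ) : ℤ)) (htv : t * ‖siteToE v‖ ≤ Rf) :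
    |∑ z ∈ S, wt z * torusK3 G r β L (z₁ + v) y z| ≤
      4 * ((C₁ + 1) / (M : ℝ) ^ 4) *
        ((κ' + ∑ z ∈ S, |wt z| * μ ((z - z₁) - v)) / ((M : ℝ) / 2) ^ 4 +
          (∑ z ∈ S, |wt z|) * (1024 * (C₁ + 1) ^ 2 / (M : ℝ) ^ 8)) := by
  classical
  haveI : NeZero (2 * L + 1) := ⟨by omega⟩
  have hM1 : 1 ≤ M := by omega
  have hM4r : (4 : ℝ) ≤ M := by exact_mod_cast hM4
  have hMpos : (0 : ℝ) < M := by linarith only [hM4r]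
  have hC₁le : C₁ ≤ C₁ + 1 := by linarith only
  have hC₁'0 : (0 : ℝ) < C₁ + 1 := by linarith only [hC₁]
  have hN8 : 2 * (M / 8) ≤ M := by omega
  -- the cubes, injectivity and far conditions
  set Qy : Finset (Literature.MathematicalPhysics.QuantumLattice.ZdEdge 4) :=
    cubeEdges (fun k => y k - (M + 1)) (2 * M + 3) with hQy
  set Qz : Finset (Literature.MathematicalPhysics.QuantumLattice.ZdEdge 4) :=
    cubeEdges (fun k => z₁ k - (M + 1)) (2 * M + 3) with hQz
  have hinj_y := injOn_torusProj_cube h4M y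
  have hinj_z := injOn_torusProj_cube h4M z₁
  have hfar_yz : ∀ e ∈ Qz ∪ (plaquettesTouching Qz).biUnion plaquetteEdges, ∀ e' ∈ Qy,
      torusEdge (2 * L + 1) e ≠ torusEdge (2 * L + 1) e' :=
    fun e he e' he' => torusEdge_ne_cube hsep_yz he he'
  have hfar_zy : ∀ e ∈ Qy ∪ (plaquettesTouching Qy).biUnion plaquetteEdges, ∀ e' ∈ Qz,
      torusEdge (2 * L + 1) e ≠ torusEdge (2 * L + 1) e' :=
    fun e he e' he' => torusEdge_ne_cube hsep_zy he he'
  -- FBL at the far site `y` (centre of `Qy`)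
  set ε₁ : ℝ := (C₁ + 1) / (M : ℝ) ^ 4 with hε₁
  have hε₁0 : 0 < ε₁ := by rw [hε₁]; positivity
  have hyker : ∀ η, |(∫ U, dens G r y U ∂(ymSpecification r.ρ β Qy η)) - pβ| ≤ ε₁ := fun η =>
    (abs_kerE_dens_centred_sub_le r hC₁ hF hM1 hb₁ y η).trans (div_le_div_of_nonneg_right hC₁le (by positivity))
  -- near-site facts (FBL inside `Qz`)
  have hnear : ∀ u : Fin 4 → ℤ, (∀ j, |u j| ≤ ((M / 8 : ℕ) : ℤ)) →
      IsCylinder (dens G r (z₁ + u)) Qz ∧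
      (M : ℝ) / 2 ≤ (depth (fun k => z₁ k - (M + 1)) (2 * M + 3) (z₁ + u) : ℝ) ∧
      (∀ η, |kerE G r β (fun k => z₁ k - (M + 1)) (2 * M + 3) η (dens G r (z₁ + u)) - pβ| ≤ 16 * C₁ / (M : ℝ) ^ 4) ∧
      |torusE G r β L (dens G r (z₁ + u)) - pβ| ≤ 16 * C₁ / (M : ℝ) ^ 4 :=
    fun u hu => near_site_facts r hC₁ hF hCA hM4 hN8 hb₁ h4M z₁ u hu
  have hdev : ∀ u : Fin 4 → ℤ, (∀ j, |u j| ≤ ((M / 8 : ℕ) : ℤ)) → ∀ η,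
      |kerE G r β (fun k => z₁ k - (M + 1)) (2 * M + 3) η (dens G r (z₁ + u)) - torusE G r β L (dens G r (z₁ + u))| ≤
        32 * C₁ / (M : ℝ) ^ 4 := by
    intro u hu η
    obtain ⟨-, -, h1, h2⟩ := hnear u hu
    have e : kerE G r β (fun k => z₁ k - (M + 1)) (2 * M + 3) η (dens G r (z₁ + u)) - torusE G r β L (dens G r (z₁ + u)) =
        (kerE G r β (fun k => z₁ k - (M + 1)) (2 * M + 3) η (dens G r (z₁ + u)) - pβ) -
          (torusE G r β L (dens G r (z₁ + u)) - pβ) := by ring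
    rw [e]
    calc _ ≤ |kerE G r β (fun k => z₁ k - (M + 1)) (2 * M + 3) η (dens G r (z₁ + u)) - pβ| +
          |torusE G r β L (dens G r (z₁ + u)) - pβ| := abs_sub _ _
      _ ≤ 16 * C₁ / (M : ℝ) ^ 4 + 16 * C₁ / (M : ℝ) ^ 4 := add_le_add (h1 η) h2
      _ = 32 * C₁ / (M : ℝ) ^ 4 := by ring
  have hzrw : ∀ z : Fin 4 → ℤ, z₁ + (z - z₁) = z := fun z => by abel
  -- the representative `x' = z₁ + v`
  set x' : Fin 4 → ℤ := z₁ + v with hx'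
  obtain ⟨hcylx', hdepthx', -, -⟩ := hnear v hv
  have hdx' := hdev v hv
  -- torus means
  set m : (Fin 4 → ℤ) → ℝ := fun z => torusE G r β L (dens G r z) with hm
  set mx : ℝ := torusE G r β L (dens G r x') with hmx
  -- the smeared near observable
  set A₂ : LGConfig 4 G → ℝ := fun U => (dens G r x' U - mx) * ∑ z ∈ S, wt z * (dens G r z U - m z) with hA₂
  have hA₂c : Continuous A₂ :=
    ((continuous_dens r x').sub continuous_const).mul
      (continuous_finsetSum S fun z _ => continuous_const.mul ((continuous_dens r z).sub continuous_const))
  have hA₂b : ∀ U, |A₂ U| ≤ (CA + |mx|) * ∑ z ∈ S, |wt z| * (CA + |m z|) := by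
    intro U
    simp only [hA₂]
    rw [abs_mul]
    have h1 : |dens G r x' U - mx| ≤ CA + |mx| := (abs_sub _ _).trans (add_le_add (hCA _ _) le_rfl)
    have h2 : |∑ z ∈ S, wt z * (dens G r z U - m z)| ≤ ∑ z ∈ S, |wt z| * (CA + |m z|) := by
      refine (Finset.abs_sum_le_sum_abs _ _).trans (Finset.sum_le_sum fun z _ => ?_)
      rw [abs_mul]
      exact mul_le_mul_of_nonneg_left ((abs_sub _ _).trans (add_le_add (hCA _ _) le_rfl)) (abs_nonneg _)
    exact mul_le_mul h1 h2 (abs_nonneg _) ((abs_nonneg _).trans h1)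
  have hA₂cyl : IsCylinder A₂ Qz := by
    intro U V hUV
    have h1 : dens G r x' U = dens G r x' V := hcylx' hUV
    have h2 : ∀ z ∈ S, dens G r z U = dens G r z V := by
      intro z hz
      have hc := (hnear (z - z₁) (hSz z hz)).1
      rw [hzrw z] at hc
      exact hc hUV
    simp only [hA₂]
    rw [h1]
    congr 1
    exact Finset.sum_congr rfl fun z hz => by rw [h2 z hz]
  -- the smeared near-pair law at `x'`
  have hcond : ∀ z ∈ S, t * ‖siteToE (z - x')‖ ≤ R ∧
      2 * ‖siteToE (z - x')‖ + 2 ≤ (depth (fun k => z₁ k - (M + 1)) (2 * M + 3) x' : ℝ) := by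
    intro z hz
    have e : siteToE (z - x') = siteToE (z - z₁) - siteToE v := by
      ext i; simp [hx', siteToE_apply]; ring
    have hn : ‖siteToE (z - x')‖ ≤ ‖siteToE (z - z₁)‖ + ‖siteToE v‖ := by rw [e]; exact norm_sub_le _ _
    have h1 : ‖siteToE (z - z₁)‖ ≤ (M : ℝ) / 8 := hsmall _ (hS_mem z hz)
    have h2 : ‖siteToE v‖ ≤ (M : ℝ) / 8 := hsmall _ htv
    refine ⟨?_, ?_⟩
    · have h3 : t * ‖siteToE (z - x')‖ ≤ t * (‖siteToE (z - z₁)‖ + ‖siteToE v‖) :=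
        mul_le_mul_of_nonneg_left hn ht0.le
      rw [mul_add] at h3
      linarith only [h3, hS_mem z hz, htv, hRfR]
    · have hd : M + 2 - M / 8 ≤ depth (fun k => z₁ k - (M + 1)) (2 * M + 3) x' := depth_centred_shift_ge z₁ v M (M / 8) hv
      have hd' : ((M + 2 - M / 8 : ℕ) : ℝ) ≤ (depth (fun k => z₁ k - (M + 1)) (2 * M + 3) x' : ℝ) := by exact_mod_cast hd
      have hd2 : (M : ℝ) / 2 + 2 ≤ ((M + 2 - M / 8 : ℕ) : ℝ) := by
        have h5 : M + 4 ≤ 2 * (M + 2 - M / 8) := by omega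
        have h6 : ((M + 4 : ℕ) : ℝ) ≤ ((2 * (M + 2 - M / 8) : ℕ) : ℝ) := by exact_mod_cast h5
        push_cast at h6
        linarith only [h6]
      linarith only [hn, h1, h2, hd', hd2]
  have hlawx : ∀ η, |∑ z ∈ S, wt z *
      (kerCov G r β (fun k => z₁ k - (M + 1)) (2 * M + 3) η (dens G r x') (dens G r z) - n (z - x'))| ≤
      (κ' + ∑ z ∈ S, |wt z| * μ ((z - z₁) - v)) / ((M : ℝ) / 2) ^ 4 := by
    intro η
    have hzx' : ∀ z, z - x' = (z - z₁) - v := fun z => by rw [hx']; abel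
    refine (hlaw η x' hcond).trans ?_
    have hnum : 0 ≤ κ' + ∑ z ∈ S, |wt z| * μ (z - x') :=
      add_nonneg hκ'.le (Finset.sum_nonneg fun z _ => mul_nonneg (abs_nonneg _) (hμ0 _))
    refine (div_le_div_of_nonneg_left hnum (by positivity) (pow_le_pow_left₀ (by positivity) hdepthx' 4)).trans (le_of_eq ?_)
    simp only [hzx']
  -- the kernel mean of `A₂`
  set p₂ : ℝ := ∑ z ∈ S, wt z * n (z - x') with hp₂
  set ε₂ : ℝ := (κ' + ∑ z ∈ S, |wt z| * μ ((z - z₁) - v)) / ((M : ℝ) / 2) ^ 4 +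
    (∑ z ∈ S, |wt z|) * (1024 * (C₁ + 1) ^ 2 / (M : ℝ) ^ 8) with hε₂
  have hSw0 : 0 ≤ ∑ z ∈ S, |wt z| := Finset.sum_nonneg fun _ _ => abs_nonneg _
  have hε₂0 : 0 < ε₂ := by
    have h1 : 0 < κ' + ∑ z ∈ S, |wt z| * μ ((z - z₁) - v) :=
      add_pos_of_pos_of_nonneg hκ' (Finset.sum_nonneg fun z _ => mul_nonneg (abs_nonneg _) (hμ0 _))
    have h2 : 0 < (κ' + ∑ z ∈ S, |wt z| * μ ((z - z₁) - v)) / ((M : ℝ) / 2) ^ 4 := div_pos h1 (by positivity)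
    have h3 : 0 ≤ (∑ z ∈ S, |wt z|) * (1024 * (C₁ + 1) ^ 2 / (M : ℝ) ^ 8) := mul_nonneg hSw0 (by positivity)
    rw [hε₂]; linarith only [h2, h3]
  have hA₂ker : ∀ η, |(∫ U, A₂ U ∂(ymSpecification r.ρ β Qz η)) - p₂| ≤ ε₂ := by
    intro η
    have h32 : (32 * C₁ / (M : ℝ) ^ 4) * (32 * C₁ / (M : ℝ) ^ 4) ≤ 1024 * (C₁ + 1) ^ 2 / (M : ℝ) ^ 8 := by
      have hc : C₁ ^ 2 ≤ (C₁ + 1) ^ 2 := pow_le_pow_left₀ hC₁ hC₁le 2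
      have e3 : (32 * C₁ / (M : ℝ) ^ 4) * (32 * C₁ / (M : ℝ) ^ 4) = 1024 * C₁ ^ 2 / (M : ℝ) ^ 8 := by
        field_simp; ring
      rw [e3]
      exact div_le_div_of_nonneg_right (by linarith only [hc]) (by positivity)
    have hdz : ∀ z ∈ S, |kerE G r β (fun k => z₁ k - (M + 1)) (2 * M + 3) η (dens G r z) - m z| ≤ 32 * C₁ / (M : ℝ) ^ 4 := by
      intro z hz
      have := hdev (z - z₁) (hSz z hz) η
      rw [hzrw z] at this
      exact this
    have h := abs_kerE_smeared_sub_le r β (fun k => z₁ k - (M + 1)) (2 * M + 3) η x' S wt mx m (fun z => n (z - x'))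
      (hdx' η) hdz (hlawx η)
    refine h.trans ?_
    rw [hε₂]
    have := mul_le_mul_of_nonneg_left h32 hSw0
    linarith only [this]
  -- the two-observable collar bound and the smeared identity
  have hcollar := abs_integral_two_sub_mean_le r β (L' := 2 * L + 1) Qy Qy Qz Qz (continuous_dens r y) hA₂c
    (fun U => hCA _ _) hA₂b (isCylinder_dens_cube r hM1 y) hA₂cyl hinj_y hinj_z hfar_yz hfar_zy hε₁0 hε₂0 hyker hA₂ker
  have hid := sum_mul_torusK3_eq_integral_smeared r β L x' y S wt mx m rfl (fun z _ => rfl)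
  rw [hid]
  exact hcollar

end Summit.QuantumFields.YangMills.Cruxes.ResponseLocalisation.Smeared

end
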